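import Summits.QuantumFields.BalabanUV.T4Continuum.Support.EffectiveLaplacianSymbol
import Literature.MathematicalPhysics.QuantumFieldTheory.Balaban1983to89.B5QGGQ145Gamma1

/-!
# T⁴ programme, spine node NE2 (U1a), tier B support row B4.d — THE ONE-STEP EFFECTIVE LAPLACIAN IS SECOND-ORDER CLOSE TO THE COARSE
# LAPLACIAN, part 2: the symbol inequality `Δ′(cen P)/|u_R(P)|² − Δ(P) ≤ C_m(d)·Δ(P)²/N²` and the vector-index form bound
# `Re⟨w, (Δ̃ − Δ)w⟩ ≤ (C_m/N²)·‖Δw‖²` (file 8 of row B4.d)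

NE2 formalisation swarm `b2b-balaban-t4-ne2-formalise-*`, seat LEAF PROVER 04, support row B4.d of `t4/formal/NE2/LEAVES.md`.
Part 1 (`EffectiveLaplacianSymbol`) reduced the effective-Laplacian excess on the vector index to a statement about ONE real symbol:
`Δ̃ = effOp Δ′ J ≤ Tᴴ Δ′ T = mulOp(g)`, `g(P) = Δ′-symbol(cen P)/|u_R(P)|²`.  This file proves the elementary trigonometric inequality
behind King's/Bałaban's «the averaging weight is `1 + O(p²)` at the central alias» and concludes:

 * §1 one direction: from `x² − x⁴/12 ≤ 2 − 2cos x` (`B5QGGQ145Gamma1.S1r_ge_taylor`) the inequality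
   `R²(2 − 2cos(x/R)) − (2 − 2cos x) ≤ (2 − 2cos x)²` (`Sxir_sub_S1r_le_sq`; `π⁴ ≤ 192`), and the inverse squared weight factor
   `|v_R(x)|⁻² ∈ [1, 1 + (2 − 2cos x)]`;
 * §2 `∏(1 + small) − 1 ≤ ρ^d·Σ small` (`prod_le_one_add_pow_mul_sum`);
 * §3 the symbols on a coset point (`lapsym_emb`, `lapsym_cenIdx_emb`, `normSq_uCen_emb`) and **`symbol_excess_le`**:
   `g(P) − Δ(P) ≤ C_m(d)·Δ(P)²/N²`, `C_m(d) = 1 + 5^d(1 + 4d)` (`Cm`);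
 * §4 **`re_form_effOpV_sub_lap_le`**: for every `w`, `Re⟨w, (effOp Δ′ J − Δ)w⟩ ≤ (C_m(d)/N²)·nsq(Δw)` on the vector index
   (`J = KingPairingPlantedLaw.JK`, given `Admissible Δ′ J`, which part 3 discharges from the 0-form coercivity).

HONEST FRAMING (T4-DAG p. 1).  `U = 1`, finite torus, free scalar layer componentwise on the vector index; finite Fourier analysis,
statements / constants OURS ([folklore]; the role of the central alias and of `u_R` is King's (4.2)–(4.3), (4.19) and Bałaban's (1.31),
cited at the definitions); a SUPPORT input of row B4.b via B4.d, NOT B4, NOT [Balaban1985BackgroundPropagators] (3.23)–(3.26) as printed;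
NE2 NOT proved; NOT infinite volume / mass gap / Clay / summit progress; spine 0/9 unchanged.  HONEST DEPENDENCY: continuum YM on T⁴ ⇐
BetaPertH ∧ nine spine estimates (0/9 proved); BetaPertH ⇐ (D1) ∧ (D4) ∧ CAP+tail; G-an2-4 gates asym, D1 and NE2/3/4.  No `sorry`.
-/

noncomputable section

open scoped BigOperators ComplexConjugate ComplexOrder Matrix Matrix.Norms.L2Operator

namespace Summit.QuantumFields.BalabanUV.T4Continuum.EffectiveLaplacianSymbolBound

open Complex (I)
open Literature.MathematicalPhysics.QuantumFieldTheory.Balaban1983to89.B4Strip (shiftr S1r Sxir S1r_eq Sxir_eq S1r_ge S1r_nonneg Sxir_nonneg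
  Sxir_le)
open Literature.MathematicalPhysics.QuantumFieldTheory.Balaban1983to89.B5Prop11Leaves (S1r_le_four)
open Literature.MathematicalPhysics.QuantumFieldTheory.Balaban1983to89.B5QGGQ145Gamma1 (S1r_ge_taylor)
open Literature.MathematicalPhysics.QuantumFieldTheory.Balaban1983to89.B5Prop11Plancherel
open Literature.MathematicalPhysics.QuantumFieldTheory.Balaban1983to89.B5Prop11Fiber (dSym d1Sym vSym uSym norm_vSym_le_one d1Sym_eq_vSym_mul
  norm_d1Sym_sq norm_dSym_sq Sxir_eq_sq_mul_S1r)
open Literature.MathematicalPhysics.QuantumFieldTheory.Balaban1983to89.B5Prop11Lower (nsq nsq_nonneg star_dotProduct_self)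
open Literature.MathematicalPhysics.QuantumFieldTheory.Balaban1983to89.B5Hk163Rate (iota shiftr_iota shiftr_symmAlias)
open Literature.MathematicalPhysics.QuantumFieldTheory.Balaban1983to89.B5G183RateTorus (exists_emb_eq blockEquiv_emb)
open Literature.MathematicalPhysics.QuantumFieldTheory.Balaban1983to89.B5G183RateTorusW (mulOp uCen cen)
open Literature.MathematicalPhysics.QuantumFieldTheory.King1986 (symmAlias symmShift symmAlias_abs_le)
open Summit.QuantumFields.BalabanUV.T4Continuum
open Summit.QuantumFields.BalabanUV.T4Continuum.OneStepEffectiveOperator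
open Summit.QuantumFields.BalabanUV.T4Continuum.KingPairingPlantedLaw (JK)
open Summit.QuantumFields.BalabanUV.T4Continuum.AbelianCovariantLaplacian (lap)
open Summit.QuantumFields.BalabanUV.T4Continuum.EffectiveLaplacianSymbol

variable {d : ℕ}

/-! ## §1 One direction -/

section OneDirection

/-- **`R²(2 − 2cos(x/R)) − (2 − 2cos x) ≤ (2 − 2cos x)²`** on `|x| ≤ π`: refining the lattice changes the one-direction Laplace symbol
only at SECOND order in the symbol itself (`≤ x⁴/12 ≤ (π⁴/192)(2 − 2cos x)² ≤ (2 − 2cos x)²`, JORDAN). [folklore] -/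
theorem Sxir_sub_S1r_le_sq (R : ℕ) (x : ℝ) (hx : |x| ≤ Real.pi) : Sxir R x - S1r x ≤ S1r x ^ 2 := by
  have h1 := Sxir_le R x
  have h2 := S1r_ge_taylor x hx
  have h3 := S1r_ge x hx
  have hπ := Real.pi_lt_d2
  have hπ0 := Real.pi_pos
  have hS := S1r_nonneg x
  have h4 : x ^ 2 ≤ Real.pi ^ 2 / 4 * S1r x := by
    rw [div_le_iff₀ (by positivity)] at h3
    nlinarith
  have h5 : x ^ 4 ≤ (Real.pi ^ 2 / 4 * S1r x) ^ 2 := by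
    have e : x ^ 4 = (x ^ 2) ^ 2 := by ring
    rw [e]; exact pow_le_pow_left₀ (sq_nonneg x) h4 2
  have hπ2 : Real.pi ^ 2 ≤ 10 := by nlinarith
  have h6 : (Real.pi ^ 2 / 4) ^ 2 ≤ 12 := by nlinarith [sq_nonneg Real.pi]
  nlinarith [h5, h6, mul_le_mul_of_nonneg_right h6 (sq_nonneg (S1r x))]

/-- the INVERSE SQUARED averaging-weight factor `|v_R(x)|⁻²` lies in `[1, 1 + (2 − 2cos x)]` on `|x| ≤ π`
(`|v_R| ≤ 1`; `|v_R|² = S₁/S_R` and `S_R − S₁ ≤ S₁²`). [folklore] -/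
theorem inv_normSq_vSym_mem {R : ℕ} [NeZero R] {c : Fin d → ℝ} (hc : ∀ ν, |c ν| ≤ Real.pi) (ν : Fin d) :
    1 ≤ (‖vSym R 0 c ν‖ ^ 2)⁻¹ ∧ (‖vSym R 0 c ν‖ ^ 2)⁻¹ ≤ 1 + S1r (c ν) := by
  have hR : 1 ≤ R := Nat.one_le_iff_ne_zero.mpr (NeZero.ne R)
  have hv1 : ‖vSym R 0 c ν‖ ≤ 1 := norm_vSym_le_one R hR 0 c ν
  have hvpos : 0 < ‖vSym R 0 c ν‖ := lt_of_lt_of_le (by positivity) (norm_vSym_zero_ge R hc ν)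
  have hv2pos : 0 < ‖vSym R 0 c ν‖ ^ 2 := by positivity
  have hv21 : ‖vSym R 0 c ν‖ ^ 2 ≤ 1 := by
    calc ‖vSym R 0 c ν‖ ^ 2 ≤ 1 ^ 2 := pow_le_pow_left₀ hvpos.le hv1 2
      _ = 1 := one_pow 2
  refine ⟨(one_le_inv₀ hv2pos).mpr hv21, ?_⟩
  by_cases h0 : dSym R 0 c ν = 0
  · have hv : vSym R 0 c ν = 1 := by unfold vSym; rw [if_pos h0]
    rw [hv, norm_one, one_pow, inv_one]
    linarith [S1r_nonneg (c ν)]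
  · have hsh : shiftr R (0 : Fin d → Fin R) c ν = c ν := by simp [shiftr]
    have hA : ‖dSym R 0 c ν‖ ^ 2 = Sxir R (c ν) := by rw [norm_dSym_sq, hsh]
    have hApos : 0 < Sxir R (c ν) := by rw [← hA]; exact pow_pos (norm_pos_iff.mpr h0) 2
    have hBA : S1r (c ν) = ‖vSym R 0 c ν‖ ^ 2 * Sxir R (c ν) := by
      rw [← hA, ← norm_d1Sym_sq c ν, d1Sym_eq_vSym_mul R hR 0 c ν, norm_mul, mul_pow]
    have h3 := Sxir_sub_S1r_le_sq R (c ν) (hc ν)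
    have key : Sxir R (c ν) * ((1 + S1r (c ν)) * ‖vSym R 0 c ν‖ ^ 2 - 1) = S1r (c ν) + S1r (c ν) ^ 2 - Sxir R (c ν) := by
      rw [hBA]; ring
    have hnn : 0 ≤ (1 + S1r (c ν)) * ‖vSym R 0 c ν‖ ^ 2 - 1 := by
      refine (mul_nonneg_iff_of_pos_left hApos).mp ?_
      rw [key]; linarith
    rw [inv_eq_one_div, div_le_iff₀ hv2pos]
    linarith

end OneDirection

/-! ## §2 A product of factors in `[1, ρ]` -/

section Product

/-- `∏ P_i ≤ 1 + ρ^{|s|}·Σ (P_i − 1)` for `1 ≤ P_i ≤ ρ`. [folklore] -/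
theorem prod_le_one_add_pow_mul_sum {ι : Type*} (s : Finset ι) (P : ι → ℝ) {ρ : ℝ} (hρ : 1 ≤ ρ)
    (h1 : ∀ i ∈ s, 1 ≤ P i) (h2 : ∀ i ∈ s, P i ≤ ρ) :
    ∏ i ∈ s, P i ≤ 1 + ρ ^ s.card * ∑ i ∈ s, (P i - 1) := by
  classical
  induction s using Finset.induction_on with
  | empty => simp
  | @insert j s hj ih =>
    rw [Finset.prod_insert hj, Finset.sum_insert hj, Finset.card_insert_of_notMem hj]
    have ih' := ih (fun i hi => h1 i (Finset.mem_insert_of_mem hi)) (fun i hi => h2 i (Finset.mem_insert_of_mem hi))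
    have hPj1 := h1 j (Finset.mem_insert_self j s)
    have hPjρ := h2 j (Finset.mem_insert_self j s)
    have hsum : 0 ≤ ∑ i ∈ s, (P i - 1) := Finset.sum_nonneg fun i hi => by linarith [h1 i (Finset.mem_insert_of_mem hi)]
    have hpow : 0 ≤ ρ ^ s.card := pow_nonneg (by linarith) _
    have hX : 0 ≤ ρ ^ s.card * ∑ i ∈ s, (P i - 1) := mul_nonneg hpow hsum
    have hρpow : 1 ≤ ρ ^ s.card * ρ := one_le_mul_of_one_le_of_one_le (one_le_pow₀ hρ) hρ
    have f1 : P j * (ρ ^ s.card * ∑ i ∈ s, (P i - 1)) ≤ ρ * (ρ ^ s.card * ∑ i ∈ s, (P i - 1)) :=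
      mul_le_mul_of_nonneg_right hPjρ hX
    have f2 : P j - 1 ≤ ρ ^ s.card * ρ * (P j - 1) := le_mul_of_one_le_left (by linarith) hρpow
    calc P j * ∏ i ∈ s, P i ≤ P j * (1 + ρ ^ s.card * ∑ i ∈ s, (P i - 1)) :=
          mul_le_mul_of_nonneg_left ih' (by linarith)
      _ ≤ 1 + ρ ^ (s.card + 1) * (P j - 1 + ∑ i ∈ s, (P i - 1)) := by
          rw [pow_succ]
          linarith [f1, f2]

end Product

/-! ## §3 The symbols on a coset point and the symbol inequality -/

section Symbols

variable (N R : ℕ) [NeZero N] [NeZero R] (M : Fin d → ℕ) [hM : ∀ μ, NeZero (M μ)]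

omit [NeZero N] [NeZero R] hM in
/-- `S₁` is `2π`-periodic. [folklore] -/
theorem S1r_add_two_pi_mul_nat (x : ℝ) (m : ℕ) : S1r (x + 2 * Real.pi * m) = S1r x := by
  unfold S1r
  rw [show x + 2 * Real.pi * m = x + m * (2 * Real.pi) by ring, Real.cos_add_nat_mul_two_pi]

omit [NeZero R] in
/-- the coarse Laplace symbol on the coset point `(k, μ, q)`: `Δ(P) = N²·Σ_ν (2 − 2cos c_ν)`, `c = cen N k p′(q)` (the coarse symbol sees only
the central alias). [folklore] -/
theorem lapsym_emb (k : Fin d → Fin N) (μ : Fin d) (q : Tor M) :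
    lapsym N M (N : ℂ) (emb N M ((k, μ), q)) = (N : ℝ) ^ 2 * ∑ ν, S1r (cen N k (sOf M q) ν) := by
  have hN0 : (N : ℝ) ≠ 0 := by exact_mod_cast NeZero.ne N
  unfold lapsym
  rw [Finset.mul_sum]
  refine Finset.sum_congr rfl fun ν _ => ?_
  rw [fsym_emb, norm_dSym_sq, Sxir_eq_sq_mul_S1r]
  congr 1
  have e : shiftr N k (sOf M q) ν / N = cen N k (sOf M q) ν + 2 * Real.pi * (symmShift N k (sOf M q) ν : ℕ) := by
    rw [shiftr_symmAlias, cen]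
    push_cast
    field_simp
  rw [e, S1r_add_two_pi_mul_nat]

/-- the FINE Laplace symbol at the central alias: `Δ′(cen P) = N²·Σ_ν R²(2 − 2cos(c_ν/R))`. [folklore] -/
theorem lapsym_cenIdx_emb (k : Fin d → Fin N) (μ : Fin d) (q : Tor M) :
    lapsym (R * N) M ((R * N : ℕ) : ℂ) (cenIdx N R M (emb N M ((k, μ), q))) = (N : ℝ) ^ 2 * ∑ ν, Sxir R (cen N k (sOf M q) ν) := by
  have hN0 : (N : ℝ) ≠ 0 := by exact_mod_cast NeZero.ne N
  have hR0 : (R : ℝ) ≠ 0 := by exact_mod_cast NeZero.ne R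
  rw [cenIdx_emb]
  unfold lapsym
  rw [Finset.mul_sum]
  refine Finset.sum_congr rfl fun ν _ => ?_
  rw [fsym_emb, norm_dSym_sq, Sxir_eq_sq_mul_S1r, Sxir_eq_sq_mul_S1r]
  have e : shiftr (R * N) (iota R k (sOf M q)) (sOf M q) ν / ((R * N : ℕ) : ℝ)
      = cen N k (sOf M q) ν / R + 2 * Real.pi * (symmShift N k (sOf M q) ν : ℕ) := by
    rw [shiftr_iota, cen]
    push_cast
    field_simp
  rw [e, S1r_add_two_pi_mul_nat]
  push_cast
  ring

/-- `|u_R(P)|² = ∏_ν |v_R(c_ν)|²`. [folklore] -/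
theorem normSq_uCen_emb (k : Fin d → Fin N) (μ : Fin d) (q : Tor M) :
    ‖uCen N R M (emb N M ((k, μ), q))‖ ^ 2 = ∏ ν, ‖vSym R 0 (cen N k (sOf M q)) ν‖ ^ 2 := by
  simp only [uCen, blockEquiv_emb, uSym]
  rw [norm_prod, Finset.prod_pow]

omit [NeZero N] [NeZero R] hM in
/-- the constant of the symbol inequality: `C_m(d) = 1 + 5^d(1 + 4d)`. [folklore] -/
def Cm (d : ℕ) : ℝ := 1 + 5 ^ d * (1 + 4 * d)

omit [NeZero N] [NeZero R] hM in
/-- `C_m ≥ 0`. [folklore] -/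
theorem Cm_nonneg (d : ℕ) : 0 ≤ Cm d := by unfold Cm; positivity

/-- **THE SYMBOL INEQUALITY**: `Δ′(cen P)/|u_R(P)|² − Δ(P) ≤ C_m(d)·Δ(P)²/N²` — the energy of the renormalised band-limited
extension exceeds the coarse Dirichlet energy only at second order in the coarse symbol. [folklore] -/
theorem symbol_excess_le (hN : 1 ≤ N) (P : Tor (fine N M) × Fin d) :
    lapsym (R * N) M ((R * N : ℕ) : ℂ) (cenIdx N R M P) / ‖uCen N R M P‖ ^ 2 - lapsym N M (N : ℂ) P
      ≤ Cm d / (N : ℝ) ^ 2 * (lapsym N M (N : ℂ) P) ^ 2 := by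
  obtain ⟨⟨⟨k, μ⟩, q⟩, rfl⟩ := exists_emb_eq M N P
  have hc : ∀ ν, |cen N k (sOf M q) ν| ≤ Real.pi := abs_cen_le N hN k (abs_sOf_le M q)
  rw [lapsym_cenIdx_emb, lapsym_emb, normSq_uCen_emb]
  set c := cen N k (sOf M q) with hc_def
  set S := ∑ ν, S1r (c ν) with hS
  set A := ∑ ν, Sxir R (c ν) with hA
  set Pv := ∏ ν, ‖vSym R 0 c ν‖ ^ 2 with hPv
  have hS0 : 0 ≤ S := Finset.sum_nonneg fun ν _ => S1r_nonneg _
  have hS4 : S ≤ 4 * d := by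
    calc S ≤ ∑ _ν : Fin d, (4 : ℝ) := Finset.sum_le_sum fun ν _ => S1r_le_four _
      _ = 4 * d := by rw [Finset.sum_const, Finset.card_univ, Fintype.card_fin, nsmul_eq_mul, mul_comm]
  have hA0 : 0 ≤ A := Finset.sum_nonneg fun ν _ => Sxir_nonneg _ _
  have hAS : A ≤ S + S ^ 2 := by
    have h1 : A ≤ ∑ ν, (S1r (c ν) + S1r (c ν) ^ 2) :=
      Finset.sum_le_sum fun ν _ => by linarith [Sxir_sub_S1r_le_sq R (c ν) (hc ν)]
    have h2 : ∑ ν, S1r (c ν) ^ 2 ≤ S ^ 2 := by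
      calc ∑ ν, S1r (c ν) ^ 2 ≤ ∑ ν, S1r (c ν) * S := Finset.sum_le_sum fun ν _ => by
              rw [sq]
              exact mul_le_mul_of_nonneg_left
                (Finset.single_le_sum (f := fun i => S1r (c i)) (fun i _ => S1r_nonneg (c i)) (Finset.mem_univ ν)) (S1r_nonneg _)
        _ = S ^ 2 := by rw [← Finset.sum_mul, sq]
    rw [Finset.sum_add_distrib] at h1
    linarith
  have hPvpos : 0 < Pv := Finset.prod_pos fun ν _ => pow_pos (lt_of_lt_of_le (by positivity) (norm_vSym_zero_ge R hc ν)) 2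
  have hPvinv : Pv⁻¹ ≤ 1 + 5 ^ d * S := by
    have e : Pv⁻¹ = ∏ ν, (‖vSym R 0 c ν‖ ^ 2)⁻¹ := by rw [hPv, Finset.prod_inv_distrib]
    rw [e]
    have h := prod_le_one_add_pow_mul_sum (Finset.univ : Finset (Fin d)) (fun ν => (‖vSym R 0 c ν‖ ^ 2)⁻¹) (ρ := 5) (by norm_num)
      (fun ν _ => (inv_normSq_vSym_mem hc ν).1)
      (fun ν _ => by linarith [(inv_normSq_vSym_mem (R := R) hc ν).2, S1r_le_four (c ν)])
    rw [Finset.card_univ, Fintype.card_fin] at h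
    refine h.trans ?_
    have h' : ∑ ν, ((‖vSym R 0 c ν‖ ^ 2)⁻¹ - 1) ≤ S := Finset.sum_le_sum fun ν _ => by linarith [(inv_normSq_vSym_mem (R := R) hc ν).2]
    have h5 : (0 : ℝ) ≤ 5 ^ d := by positivity
    nlinarith [mul_le_mul_of_nonneg_left h' h5]
  have hN0 : (N : ℝ) ≠ 0 := by exact_mod_cast NeZero.ne N
  have key : A * Pv⁻¹ - S ≤ Cm d * S ^ 2 := by
    have h1 : A * Pv⁻¹ ≤ (S + S ^ 2) * (1 + 5 ^ d * S) := mul_le_mul hAS hPvinv (inv_nonneg.mpr hPvpos.le) (by positivity)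
    have h2 : S ^ 3 ≤ 4 * d * S ^ 2 := by
      rw [pow_succ', sq] at *
      exact mul_le_mul_of_nonneg_right hS4 (mul_self_nonneg S)
    have h5 : (0 : ℝ) ≤ 5 ^ d := by positivity
    calc A * Pv⁻¹ - S ≤ (S + S ^ 2) * (1 + 5 ^ d * S) - S := by linarith
      _ = S ^ 2 + 5 ^ d * S ^ 2 + 5 ^ d * S ^ 3 := by ring
      _ ≤ S ^ 2 + 5 ^ d * S ^ 2 + 5 ^ d * (4 * d * S ^ 2) := by nlinarith [mul_le_mul_of_nonneg_left h2 h5]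
      _ = Cm d * S ^ 2 := by unfold Cm; ring
  calc (N : ℝ) ^ 2 * A / Pv - (N : ℝ) ^ 2 * S = (N : ℝ) ^ 2 * (A * Pv⁻¹ - S) := by rw [div_eq_mul_inv]; ring
    _ ≤ (N : ℝ) ^ 2 * (Cm d * S ^ 2) := mul_le_mul_of_nonneg_left key (sq_nonneg _)
    _ = Cm d / (N : ℝ) ^ 2 * ((N : ℝ) ^ 2 * S) ^ 2 := by field_simp

end Symbols

/-! ## §4 The vector-index form bound -/

section FormBound

variable (N R : ℕ) [NeZero N] [NeZero R] (M : Fin d → ℕ) [hM : ∀ μ, NeZero (M μ)]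

omit [NeZero R] in
/-- scalars pass into the symbol. [folklore] -/
theorem smul_mulOp (a : ℂ) (V : Tor (fine N M) × Fin d → ℂ) : a • mulOp N M V = mulOp N M (fun i => a * V i) := by
  unfold mulOp
  rw [← Matrix.smul_mul, ← Matrix.mul_smul]
  congr 2
  ext i j
  rw [Matrix.smul_apply, Matrix.diagonal_apply, Matrix.diagonal_apply, smul_eq_mul]
  split_ifs <;> simp

omit [NeZero R] in
/-- `Δ ≥ 0` on the vector index. [folklore] -/
theorem lap_posSemidef (n : ℕ) [NeZero n] (c : ℂ) : (lap (fine n M) c).PosSemidef := by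
  unfold lap
  exact Finset.sum_induction _ (fun X => Matrix.PosSemidef X) (fun a b ha hb => ha.add hb) Matrix.PosSemidef.zero
    (fun ν _ => Matrix.posSemidef_conjTranspose_mul_self _)

/-- **THE VECTOR-INDEX EXCESS BOUND**: `Re⟨w, (Δ̃ − Δ)w⟩ ≤ (C_m(d)/N²)·nsq(Δw)` for King's planting `J` and the one-step effective
Laplacian `Δ̃ = effOp Δ′ J` (given admissibility, discharged in part 3). [folklore] -/
theorem re_form_effOpV_sub_lap_le (hN : 1 ≤ N) (h : Admissible (lap (fine (R * N) M) ((R * N : ℕ) : ℂ)) (JK N R M))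
    (w : Tor (fine N M) × Fin d → ℂ) :
    (star w ⬝ᵥ ((effOp (lap (fine (R * N) M) ((R * N : ℕ) : ℂ)) (JK N R M) - lap (fine N M) (N : ℂ)) *ᵥ w)).re
      ≤ Cm d / (N : ℝ) ^ 2 * nsq (lap (fine N M) (N : ℂ) *ᵥ w) := by
  -- (1) the variational bound against the spectral test extension
  have h1 := form_effOp_le_of_right_inverse h (lap_posSemidef M (R * N) _) (JKH_mul_Text N R M hN) w
  rw [conj_lap_Text N R M hN] at h1
  -- (2) the symbol inequality, as forms
  set g : Tor (fine N M) × Fin d → ℝ := fun P => lapsym (R * N) M ((R * N : ℕ) : ℂ) (cenIdx N R M P) / ‖uCen N R M P‖ ^ 2 with hg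
  have h2 := re_form_mulOp_le N M (f := fun P => g P - lapsym N M (N : ℂ) P)
    (g := fun P => Cm d / (N : ℝ) ^ 2 * (lapsym N M (N : ℂ) P) ^ 2) (fun P => by simpa only [hg] using symbol_excess_le N R M hN P) w
  have e1 : mulOp N M (fun P => (((g P - lapsym N M (N : ℂ) P : ℝ)) : ℂ))
      = mulOp N M (fun P => ((g P : ℝ) : ℂ)) - lap (fine N M) (N : ℂ) := by
    rw [lap_eq_mulOp, mulOp_sub]
    congr 1; funext P; push_cast; ring
  have e2 : mulOp N M (fun P => (((Cm d / (N : ℝ) ^ 2 * (lapsym N M (N : ℂ) P) ^ 2 : ℝ)) : ℂ))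
      = ((Cm d / (N : ℝ) ^ 2 : ℝ) : ℂ) • (lap (fine N M) (N : ℂ) * lap (fine N M) (N : ℂ)) := by
    rw [lap_eq_mulOp, mulOp_mul, smul_mulOp]
    congr 1; funext P; push_cast; ring
  rw [e1, e2, Matrix.sub_mulVec, dotProduct_sub, Complex.sub_re, Matrix.smul_mulVec, dotProduct_smul, smul_eq_mul,
    Complex.re_ofReal_mul] at h2
  have e3 : (star w ⬝ᵥ ((lap (fine N M) (N : ℂ) * lap (fine N M) (N : ℂ)) *ᵥ w)).re = nsq (lap (fine N M) (N : ℂ) *ᵥ w) := by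
    have h := re_form_lap_sq N M (N : ℝ) w
    rwa [Complex.ofReal_natCast] at h
  rw [e3] at h2
  rw [Matrix.sub_mulVec, dotProduct_sub, Complex.sub_re]
  linarith

end FormBound

end Summit.QuantumFields.BalabanUV.T4Continuum.EffectiveLaplacianSymbolBound

end
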